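import Mathlib.LinearAlgebra.Matrix.Kronecker
import Mathlib.LinearAlgebra.Matrix.Permutation
import Literature.Computability.AlgebraicComplexity.EquivariantDC
import Literature.Computability.AlgebraicComplexity.StandardFamilies
import HarnessLib

/-!
# Named facts: Landsberg–Ressayre's exponential lower bounds for EQUIVARIANT determinantal
representations of the permanent (LR 2017, Thms. 2.1 and 2.8)

Topic `Literature/Computability/AlgebraicComplexity`; cite item `wi-03851` (route
ValiantsHypothesis/DetQP, stmt-0319), over the tree's `IsEquivariantDetRepr Γ f A`
(`EquivariantDC.lean`) and `perPoly` (`StandardFamilies.lean`).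

**Landsberg–Ressayre 2017** (Differential Geom. Appl. 55; arXiv:1508.05788), with
`M_m(ℂ) = Hom(F, E)`, `GL(E) × GL(F)` acting by `(A,B)·x = A x B⁻¹`, `T^{GL(E)}` the diagonal
torus and `N(T^{GL(E)}) = T^{GL(E)} ⋊ 𝔖_m` its normaliser (monomial matrices),
`G_{perm_m} ≅ [(N(T^{GL(E)}) × N(T^{GL(F)}))/ℂ*] ⋊ ℤ₂` (`ℤ₂` = transposition):
* **Thm. 2.1.** For `m ≥ 3`, `edc(perm_m) = C(2m, m) - 1` (representations respecting ALL of
  `G_{perm_m}`, LR Defs. 1.2–1.3, 1.5).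
* **Thm. 2.8.** For `m ≥ 3`, every determinantal representation of `perm_m` respecting
  `N(T^{GL(E)})` (left multiplication by permutation and diagonal matrices — "about half the
  symmetries") has size `n ≥ 2^m - 1`; Grenet's representation respects it and has size `2^m - 1`.

**What transfers to the tree's notion, and what is vendored.** LR's "`Ã` respects `G`"
(Def. 1.3) asks each `γ ∈ G` to be induced by SOME element of the symmetry group
`G_A ⊆ G_{det_n} ≅ (GL_n × GL_n)/ℂ* ⋊ ℤ₂` of the representation; the tree's
`IsEquivariantDetRepr Γ f A` asks for an EXACT lift `A(γ·x) = g A(x) h⁻¹` with `(g,h) ∈ GL_n × GL_n`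
(no transpose, no scalar ambiguity). Every tree-equivariant representation therefore respects `Γ`
in LR's sense, so LR's LOWER BOUNDS transfer verbatim to the tree's notion (for any `Γ` whose
elements are genuine symmetries realised in `GL(V)`, including the transposition of `M_m`), while
the matching UPPER bounds (Grenet's `2^m - 1`; LR's `C(2m,m) - 1` construction) would need the
exact-lift property of those constructions and are NOT vendored. Hence we record the two lower
bounds:
* `lr_left_equivariant_lower` (Thm. 2.8): `Γ = leftMonomialSubst m` (substitutions
  `x ↦ g x`, `g` monomial) ⇒ size `≥ 2^m - 1`;
* `lr_full_equivariant_lower` (Thm. 2.1, `≥` half): `Γ = permSymmetrySubst m` (generated by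
  `x ↦ g x`, `x ↦ x h`, `g, h` monomial, and `x ↦ xᵀ`) ⇒ size `≥ C(2m, m) - 1`.
The symmetry subgroups are subgroups of `GL (Fin m × Fin m) ℂ` given by Kronecker products
`g ⊗ 1`, `1 ⊗ h` and the transposition permutation matrix; as SETS of substitutions they do not
depend on the left/right/inverse convention of `linSubst` (each generating set is closed under
`γ ↦ γᵀ, γ⁻¹`). Nothing is asserted.

## References

* J. M. Landsberg, N. Ressayre, *Permanent v. determinant: an exponential lower bound assuming
  symmetry and a potential path towards Valiant's conjecture*, Differential Geom. Appl. 55 (2017)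
  146–166, arXiv:1508.05788: Defs. 1.2, 1.3, 1.5; Thm. 2.1; Thm. 2.8; §2.1 (`G_{perm_m}`).
* B. Grenet, *An upper bound for the permanent versus determinant problem* (2011) (`2^m - 1`).
-/

noncomputable section

open Matrix MvPolynomial
open scoped Kronecker

namespace Literature.Computability.AlgebraicComplexity

variable (k : Type*) [Field k] (m : ℕ)

/-! ### The symmetry subgroups as groups of linear substitutions of the `m²` variables -/

/-- Monomial matrices (products of permutation matrices and invertible diagonal matrices): the
normaliser `N(T) = T ⋊ 𝔖_m` of the diagonal torus in `GL_m`, as a subgroup of `GL (Fin m) k`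
(closure of the permutation matrices and the invertible diagonals). [Landsberg–Ressayre 2017,
§2.1 (`N(T^{GL(E)}) = T^{GL(E)} ⋊ 𝔖_m`)] [cite: LandsbergRessayre2017, §2.1] -/
def monomialSubgroup : Subgroup (GL (Fin m) k) :=
  Subgroup.closure
    ({g | ∃ π : Equiv.Perm (Fin m), (g : Matrix (Fin m) (Fin m) k) = π.permMatrix k} ∪
      {g | ∃ d : Fin m → k, (g : Matrix (Fin m) (Fin m) k) = Matrix.diagonal d})

/-- **Left symmetries** `x ↦ g · x` of `M_m` (`g` monomial), as linear substitutions of the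
`m²` variables `x_{ij}`: the Kronecker products `g ⊗ 1` — LR's `N(T^{GL(E)})` acting on
`Hom(F, E)`. [Landsberg–Ressayre 2017, §2.1, Thm. 2.8] [cite: LandsbergRessayre2017, §2.1] -/
def leftMonomialSubst : Subgroup (GL (Fin m × Fin m) k) :=
  Subgroup.closure
    {γ | ∃ g ∈ monomialSubgroup k m,
      (γ : Matrix (Fin m × Fin m) (Fin m × Fin m) k) = (g : Matrix (Fin m) (Fin m) k) ⊗ₖ 1}

/-- **Right symmetries** `x ↦ x · h` (`h` monomial): the Kronecker products `1 ⊗ h` — LR's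
`N(T^{GL(F)})`. [Landsberg–Ressayre 2017, §2.1] [cite: LandsbergRessayre2017, §2.1] -/
def rightMonomialSubst : Subgroup (GL (Fin m × Fin m) k) :=
  Subgroup.closure
    {γ | ∃ h ∈ monomialSubgroup k m,
      (γ : Matrix (Fin m × Fin m) (Fin m × Fin m) k) = 1 ⊗ₖ (h : Matrix (Fin m) (Fin m) k)}

/-- The transposition `x ↦ xᵀ` of `M_m` as a permutation matrix of the `m²` variables (the `ℤ₂`
of `G_{perm_m}`). [Landsberg–Ressayre 2017, §1 (4), §2.1] [cite: LandsbergRessayre2017, §2.1] -/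
def transposeSubstSet : Set (GL (Fin m × Fin m) k) :=
  {γ | (γ : Matrix (Fin m × Fin m) (Fin m × Fin m) k) = Equiv.Perm.permMatrix k (Equiv.prodComm (Fin m) (Fin m))}

/-- **The (realised) symmetry group of `perm_m`** as substitutions of the variables: generated by
the left and right monomial symmetries and the transposition — LR's
`G_{perm_m} ≅ [(N(T^{GL(E)}) × N(T^{GL(F)}))/ℂ*] ⋊ ℤ₂` realised in `GL(M_m)`.
[Landsberg–Ressayre 2017, §2.1] [cite: LandsbergRessayre2017, §2.1] -/
def permSymmetrySubst : Subgroup (GL (Fin m × Fin m) k) :=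
  Subgroup.closure
    ((leftMonomialSubst k m : Set (GL (Fin m × Fin m) k)) ∪ rightMonomialSubst k m ∪
      transposeSubstSet k m)

/-! ### Named facts (lower bounds only; see the module doc) -/

/-- NAMED FACT (**Landsberg–Ressayre 2017, Thm. 2.8**): for `m ≥ 3`, every affine determinantal
representation of `perm_m` over `ℂ` which is equivariant (in the tree's exact-lift sense, hence in
LR's sense) for the LEFT monomial symmetries `x ↦ g x` has size at least `2^m - 1` (Grenet's
representation shows this is optimal in LR's sense — not vendored). Users take
`(h : lr_left_equivariant_lower)`. [Landsberg–Ressayre 2017, Thm. 2.8] [cite: LandsbergRessayre2017, Thm. 2.8] -/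
def lr_left_equivariant_lower : Prop :=
  ∀ m : ℕ, 3 ≤ m → ∀ (n : ℕ) (A : Matrix (Fin n) (Fin n) (MvPolynomial (Fin m × Fin m) ℂ)),
    IsEquivariantDetRepr (leftMonomialSubst ℂ m) (perPoly (Fin m) ℂ) A → 2 ^ m - 1 ≤ n

/-- NAMED FACT (**Landsberg–Ressayre 2017, Thm. 2.1, lower bound**): for `m ≥ 3`, every affine
determinantal representation of `perm_m` over `ℂ` equivariant (exact-lift sense) for the full
realised symmetry group `permSymmetrySubst` (left and right monomial symmetries and transposition)
has size at least `C(2m, m) - 1` (`≈ 4^m`; LR also construct one of exactly this size in their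
sense, giving `edc(perm_m) = C(2m,m) - 1` — the equality is not vendored). Users take
`(h : lr_full_equivariant_lower)`. [Landsberg–Ressayre 2017, Thm. 2.1] [cite: LandsbergRessayre2017, Thm. 2.1] -/
def lr_full_equivariant_lower : Prop :=
  ∀ m : ℕ, 3 ≤ m → ∀ (n : ℕ) (A : Matrix (Fin n) (Fin n) (MvPolynomial (Fin m × Fin m) ℂ)),
    IsEquivariantDetRepr (permSymmetrySubst ℂ m) (perPoly (Fin m) ℂ) A → Nat.choose (2 * m) m - 1 ≤ n

/-! ### API -/

/-- The left symmetries lie in the full symmetry group. [folklore] -/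
theorem leftMonomialSubst_le_permSymmetrySubst : leftMonomialSubst k m ≤ permSymmetrySubst k m :=
  fun _ hγ => Subgroup.subset_closure (Or.inl (Or.inl hγ))

/-- Hence a fully equivariant representation is left-equivariant, and the Thm. 2.8 bound applies
to it as well (consistency: `2^m - 1 ≤ C(2m,m) - 1`). [Landsberg–Ressayre 2017, Thms. 2.1, 2.8] [folklore] -/
theorem two_pow_sub_one_le_of_full (h : lr_left_equivariant_lower) {m : ℕ} (hm : 3 ≤ m) {n : ℕ}
    {A : Matrix (Fin n) (Fin n) (MvPolynomial (Fin m × Fin m) ℂ)}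
    (hA : IsEquivariantDetRepr (permSymmetrySubst ℂ m) (perPoly (Fin m) ℂ) A) : 2 ^ m - 1 ≤ n :=
  h m hm n A (hA.anti (leftMonomialSubst_le_permSymmetrySubst ℂ m))

/-- In terms of `edc`: if some left-equivariant representation exists (so that `edc` is not the
junk `0`), then `edc_{left}(perm_m) ≥ 2^m - 1`. [Landsberg–Ressayre 2017, Thm. 2.8] [folklore] -/
theorem le_equivariantDetComplexity_left (h : lr_left_equivariant_lower) {m : ℕ} (hm : 3 ≤ m)
    (hex : ∃ n, HasEquivariantDetRepr (leftMonomialSubst ℂ m) (perPoly (Fin m) ℂ) n) :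
    2 ^ m - 1 ≤ equivariantDetComplexity (leftMonomialSubst ℂ m) (perPoly (Fin m) ℂ) := by
  obtain ⟨A, hA⟩ : HasEquivariantDetRepr (leftMonomialSubst ℂ m) (perPoly (Fin m) ℂ)
      (equivariantDetComplexity (leftMonomialSubst ℂ m) (perPoly (Fin m) ℂ)) := Nat.sInf_mem hex
  exact h m hm _ A hA

/-- The identity substitution is a left monomial symmetry (non-emptiness of the generating set:
`1 = 1 ⊗ 1` with `1` a permutation matrix). [folklore] -/
example : (1 : GL (Fin m × Fin m) k) ∈ leftMonomialSubst k m := Subgroup.one_mem _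

end Literature.Computability.AlgebraicComplexity
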